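import Summits.SmoothPoincare4.SmoothPoincare4.Theorems.ConvexBisectionAcyclicBisectionRigidityStubPropertyRClosing
import Summits.SmoothPoincare4.SmoothPoincare4.Theorems.ConvexBisectionAcyclicBisectionRigidityStubPropertyRGluing
import HarnessLib

/-!
# Stub `stub_propertyR_recognition` of line `seam-duality-cancellation` for crux `ConvexBisection.AcyclicBisectionRigidity`
(item stmt-SmoothPoincare4-10507, route route-SmoothPoincare4-ConvexBisection)

The Property-R endgame of the line (Stub 2 of the lead's skeleton, reshape s1, 2026-08-16): a homotopy
4-sphere `M` carrying a Morse function with NO critical point of index `1` and EXACTLY ONE of index `2` is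
diffeomorphic to `S⁴`, modulo the four named facts C (Cerf `Γ₄ = 0`), R (Gabai's Property R),
L (Laudenbach–Poénaru) and T (the trace bridge), fed in as leading hypotheses exactly as in the sibling line
`exchange-recognition` (skeleton r3).

It is LITERALLY the case `c₂ = 1 ≤ 1` of the landed
`ExchangeRecognition.stub_propertyRClosing` (Theorems/ConvexBisectionAcyclicBisectionRigidityStubPropertyRClosing.lean,
p91206: compactness and connectedness of `M` from `M ≃ₕ S⁴`, unique minimum, `χ = 2`, self-indexing
rearrangement, cut above the 2-handle into a knot trace `P` and a `(1,1)`-handlebody `V`; the `c₂ = 0` branch is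
a twisted sphere, closed by Cerf) applied to the landed gluing form
`ExchangeRecognition.stub_propertyRGluing` (Theorems/ConvexBisectionAcyclicBisectionRigidityStubPropertyRGluing.lean,
p94171: `S³_n(K) = ∂P ≅ ∂V = S¹ × S²` forces `n = 0`, Property R makes `K` the unknot, `P ≅ S² × D²`, and
`S² × D² ∪_φ S¹ × B³ ≅ S⁴` for every `φ` by Laudenbach–Poénaru — Gompf–Scharlemann–Thompson 2010 Prop. 9.2,
case `n = 1`).  One proof serves both round-2 lines of the crux.

## References

* D. Gabai, *Foliations and the topology of 3-manifolds III*, J. Differential Geom. 26 (1987), Cor. 8.3. [GabaiJDG1987]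
* F. Laudenbach, V. Poénaru, *A note on 4-dimensional handlebodies*, Bull. SMF 100 (1972). [LaudenbachPoenaruBSMF1972]
* J. Cerf, *Sur les difféomorphismes de la sphère de dimension trois (Γ₄ = 0)*, LNM 53 (1968). [CerfDiffeoSphere1968]
* R. Gompf, M. Scharlemann, A. Thompson, *Fibered knots and potential counterexamples…*, Geom. Topol. 14 (2010), Prop. 9.2.
-/

noncomputable section

-- The namespace is prescribed by the crux protocol (`Summit.<P>.<Sub>.Theorems.<Crux>.<Line>`
-- with `P = Sub = SmoothPoincare4`), hence the duplicated component.
set_option linter.dupNamespace false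

open scoped Manifold ContDiff Topology ContinuousMap
open Set Function Literature.Topology.FourManifolds

namespace Summit.SmoothPoincare4.SmoothPoincare4.Theorems.AcyclicBisectionRigidity.SeamDualityCancellation

open Summit.SmoothPoincare4.SmoothPoincare4.Theorems.AcyclicBisectionRigidity.ExchangeRecognition
  (stub_propertyRClosing stub_propertyRGluing)

/-- **Property-R recognition (Stub 2 of line `seam-duality-cancellation`), modulo the named facts C, R, L, T.**
A homotopy 4-sphere `M` with a Morse function `F` having no index-1 critical point and exactly one index-2
critical point is diffeomorphic to `S⁴`: given Cerf's `Γ₄ = 0` (`hC`), Gabai's Property R (`hPR`),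
Laudenbach–Poénaru (`hLP`) and the trace bridge (`hT`), this is the case `c₂ ≤ 1` of
`ExchangeRecognition.stub_propertyRClosing` with the gluing form `ExchangeRecognition.stub_propertyRGluing`.
[cite: GabaiJDG1987, Cor. 8.3] [cite: LaudenbachPoenaruBSMF1972, main theorem] [cite: CerfDiffeoSphere1968, Γ₄ = 0]
[cite: GompfScharlemannThompson2010, Prop. 9.2 (case n = 1)] -/
theorem stub_propertyR_recognition (hC : cerf_twistedSphere_four)
    (hPR : isUnknot_of_isIntegralSurgery_zero) (hLP : exists_diffeomorph_comp_incl_eq.{0})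
    (hT : exists_framedKnot_of_hasHandleDecomposition_oneZeroOne)
    (M : Type) [TopologicalSpace M] [T2Space M] [SecondCountableTopology M]
    [ChartedSpace (EuclideanSpace ℝ (Fin 4)) M] [IsManifold (𝓡 4) ∞ M]
    (hM : M ≃ₕ Metric.sphere (0 : EuclideanSpace ℝ (Fin 5)) 1)
    (F : M → ℝ) (hF : IsMorse (𝓡 4) F) (h1 : criticalSetOfIndex (𝓡 4) F 1 = ∅)
    (h2 : (criticalSetOfIndex (𝓡 4) F 2).ncard = 1) :
    Nonempty (M ≃ₘ⟮𝓡 4, 𝓡 4⟯ Metric.sphere (0 : EuclideanSpace ℝ (Fin 5)) 1) :=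
  stub_propertyRClosing hC (stub_propertyRGluing hPR hLP hT) M hM F hF h1 h2.le

end Summit.SmoothPoincare4.SmoothPoincare4.Theorems.AcyclicBisectionRigidity.SeamDualityCancellation

end
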